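import Mathlib
import Summits.KontsevichZagierPeriods.Zeta5Search.WedgeDictionary
import Summits.KontsevichZagierPeriods.Zeta5Search.DualSeriesContiguity
import HarnessLib

/-!
# The wedge-square dictionary: consequences and consistency (partner independence; the shape of BZ (4))

Cell `pub-zeta5` (HONEST FRAMING: systematic search; no irrationality claim unless certified), typer seat
generation 3.  OUR work (Summit side), on top of `WedgeDictionary.lean` (canonical coefficients `U, W, V`, the
decomposition theorem `F̃₇ = Uζ(5) + Wζ(3) − V`, the conjecture `wedgeDictionary`) and `DualSeriesContiguity.lean`
(Lemma 1).  Everything here is PROVED; the conjecture enters only as an explicit hypothesis `(hW : wedgeDictionary)`.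

* LINEARITY OF THE CANONICAL COEFFICIENTS under the partner shift (`coeff_update_sub`): for `b` in the box with
  `b_j, b_k ≤ b₀` and `Σ b ≤ 3b₀`, writing `κ = (b_j − b_k)(b₀ − b_j − b_k)`,
  `U(b+e_j) − U(b+e_k) = κ·U(b)`, `W(b+e_j) − W(b+e_k) = κ·W(b)`, `V(b+e_j) − V(b+e_k) = κ·V(b)` — from
  `numPoly_{b+e_j} = (X+b_j)(X+b₀−b_j)·numPoly_b` and UNIQUENESS of partial fractions (the coefficient-level
  form of Lemma 1; gen-1/gen-2 observed "the same multiplier for all seven partners").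
* PARTNER INDEPENDENCE of both right-hand sides of the conjecture (`wedgeQ_partner_independent`,
  `wedgeI_partner_independent`): `U(b)W(b+e_j) − U(b+e_j)W(b)` and
  `(W(b+e_j) − 2ζ(2)U(b+e_j))·F̃₇(b) − (W(b) − 2ζ(2)U(b))·F̃₇(b+e_j)` do not depend on `j` — so the conjecture is
  consistent across partners and it suffices to verify/prove it for one admissible partner.
* THE CONJECTURE IMPLIES THE SHAPE OF BZ (4) WITH EXPLICIT `P̂, P` (`cellularIntegral_eq_of_wedgeDictionary`,
  `decomposition_shape_of_wedgeDictionary`): `I(a) = Q(a)(2ζ(5) + 4ζ(3)ζ(2)) − 4P̂ζ(2) − 2P` with the minors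
  `P̂ = ρ(UV′ − U′V)`, `P = ρ(W′V − WV′)` (gen-1's "equivalently").
-/

noncomputable section

open Finset Polynomial

namespace Summit.KontsevichZagierPeriods.Zeta5Search.WedgeDictionary

open Summit.KontsevichZagierPeriods.Zeta5Search.DualSeries
open Literature.NumberTheory.Irrationality.BrownZudilin2022 (vwpDual bOfA Converges cellularIntegral QOf)
open Literature.NumberTheory.Transcendental (zetaValue)
open Literature.NumberTheory.Transcendental.BallRivoal (pfEval harm pf_unique pfEval_sub' pfEval_const_mul)

/-! ### From the conjecture's region to the hypotheses of the decomposition theorem -/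

/-- Region ⇒ box. -/
theorem inBox_of_region (b : ℕ → ℤ) (hreg : ∀ i ∈ Icc 1 7, 0 ≤ b i ∧ 2 * b i ≤ b 0 + 1)
    {j : ℕ} (hj : j ∈ Icc 1 7) (hpart : 2 * (b j + 1) ≤ b 0 + 1) : InBox b := by
  have h0 : 0 ≤ b 0 := by have := (hreg j hj).1; linarith
  exact ⟨h0, fun i hi => by
    have h := hreg (i + 1) (by have := mem_range.1 hi; exact mem_Icc.2 ⟨by omega, by omega⟩)
    exact ⟨h.1, by linarith [h.1, h.2]⟩⟩

/-- `d(b) ≥ 0` ⇒ the parameter-sum bound (with room for one shift). -/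
theorem sum_le_of_dOf (b : ℕ → ℤ) (hd : 0 ≤ dOf b) : ∑ i ∈ range 7, b (i + 1) ≤ 3 * b 0 + 1 := by
  unfold dOf at hd; linarith

/-- Box and sum bound for a partner shift `b + e_{i+1}` with `b_{i+1} ≤ b₀`, `d(b) ≥ 0`. -/
theorem box_update (b : ℕ → ℤ) (hb : InBox b) (hd : 0 ≤ dOf b) {i : ℕ} (hi : i ∈ range 7)
    (hle : b (i + 1) ≤ b 0) :
    InBox (Function.update b (i + 1) (b (i + 1) + 1)) ∧
      ∑ l ∈ range 7, Function.update b (i + 1) (b (i + 1) + 1) (l + 1) ≤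
        3 * Function.update b (i + 1) (b (i + 1) + 1) 0 + 1 := by
  refine ⟨inBox_update b hb hi hle, ?_⟩
  rw [sum_update b hi, Function.update_of_ne (show (0 : ℕ) ≠ i + 1 by omega)]
  unfold dOf at hd
  linarith

/-! ### Linearity of the canonical coefficients under the partner shift -/

/-- Coefficient-level Lemma 1: if `c, cᵢ, cₖ` are partial-fraction data of `R_b, R_{b+e_{i+1}}, R_{b+e_{k+1}}`
then `cᵢ − cₖ = κ·c` entrywise, `κ = (b_{i+1} − b_{k+1})(b₀ − b_{i+1} − b_{k+1})` (uniqueness of partial fractions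
applied to `R_{b+e_i} − R_{b+e_k} − κR_b = 0`, which holds because `numPoly_{b+e_i} = (X+b_i)(X+b₀−b_i)·numPoly_b`). -/
theorem pfData_update_sub (b : ℕ → ℤ) (hb : InBox b) {i k : ℕ} (hi : i ∈ range 7) (hk : k ∈ range 7)
    {c ci ck : ℕ → ℕ → ℚ} (hc : IsPFData b c)
    (hci : IsPFData (Function.update b (i + 1) (b (i + 1) + 1)) ci)
    (hck : IsPFData (Function.update b (k + 1) (b (k + 1) + 1)) ck)
    {o p : ℕ} (ho : o < 6) (hp : p ≤ (b 0).toNat) :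
    ci o p - ck o p = ((b (i + 1) - b (k + 1)) * (b 0 - b (i + 1) - b (k + 1)) : ℚ) * c o p := by
  set κ : ℚ := ((b (i + 1) - b (k + 1)) * (b 0 - b (i + 1) - b (k + 1)) : ℚ) with hκ
  have h0i : Function.update b (i + 1) (b (i + 1) + 1) 0 = b 0 := Function.update_of_ne (by omega) _ _
  have h0k : Function.update b (k + 1) (b (k + 1) + 1) 0 = b 0 := Function.update_of_ne (by omega) _ _
  have h := pf_unique (b 0).toNat 6 (fun o p => (ci o p - ck o p) - κ * c o p) 0 (fun t _ => by
    have hpole : ∀ p, p ≤ (b 0).toNat → (t : ℚ) + p + 1 ≠ 0 := fun p _ => by positivity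
    have e1 : pfEval (b 0).toNat 6 (fun o p => (ci o p - ck o p) - κ * c o p) (t : ℚ) =
        pfEval (b 0).toNat 6 ci t - pfEval (b 0).toNat 6 ck t - κ * pfEval (b 0).toNat 6 c t := by
      rw [pfEval_sub' _ _ (fun o p => ci o p - ck o p), pfEval_sub', pfEval_const_mul]
    have eci := hci (t : ℚ) (by rw [h0i]; exact hpole)
    have eck := hck (t : ℚ) (by rw [h0k]; exact hpole)
    rw [h0i] at eci
    rw [h0k] at eck
    rw [e1, eci, eck, hc _ hpole, numPoly_update b hi (hb.2 i hi).1, numPoly_update b hk (hb.2 k hk).1]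
    simp only [mul_comp, add_comp, X_comp, C_comp, eval_mul, eval_add, eval_X, eval_C]
    rw [hκ]
    push_cast
    ring) o p ho hp
  exact sub_eq_zero.1 h

/-- LINEARITY of `U, W, V` under the partner shift: for `b` in the box with `d(b) ≥ 0`, `b_{i+1}, b_{k+1} ≤ b₀`:
`U(b+e_i) − U(b+e_k) = κU(b)`, `W(b+e_i) − W(b+e_k) = κW(b)`, `V(b+e_i) − V(b+e_k) = κV(b)`,
`κ = (b_i − b_k)(b₀ − b_i − b_k)` (indices written `i+1`, `k+1`). -/
theorem coeff_update_sub (b : ℕ → ℤ) (hb : InBox b) (hd : 0 ≤ dOf b) {i k : ℕ} (hi : i ∈ range 7)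
    (hk : k ∈ range 7) (hli : b (i + 1) ≤ b 0) (hlk : b (k + 1) ≤ b 0) :
    coeffU (Function.update b (i + 1) (b (i + 1) + 1)) - coeffU (Function.update b (k + 1) (b (k + 1) + 1)) =
        ((b (i + 1) - b (k + 1)) * (b 0 - b (i + 1) - b (k + 1)) : ℚ) * coeffU b ∧
      coeffW (Function.update b (i + 1) (b (i + 1) + 1)) - coeffW (Function.update b (k + 1) (b (k + 1) + 1)) =
        ((b (i + 1) - b (k + 1)) * (b 0 - b (i + 1) - b (k + 1)) : ℚ) * coeffW b ∧
      coeffV (Function.update b (i + 1) (b (i + 1) + 1)) - coeffV (Function.update b (k + 1) (b (k + 1) + 1)) =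
        ((b (i + 1) - b (k + 1)) * (b 0 - b (i + 1) - b (k + 1)) : ℚ) * coeffV b := by
  obtain ⟨c, hc⟩ := exists_isPFData b hb (sum_le_of_dOf b hd)
  obtain ⟨hbi, hsi⟩ := box_update b hb hd hi hli
  obtain ⟨hbk, hsk⟩ := box_update b hb hd hk hlk
  obtain ⟨ci, hci⟩ := exists_isPFData _ hbi hsi
  obtain ⟨ck, hck⟩ := exists_isPFData _ hbk hsk
  have h0i : Function.update b (i + 1) (b (i + 1) + 1) 0 = b 0 := Function.update_of_ne (by omega) _ _
  have h0k : Function.update b (k + 1) (b (k + 1) + 1) 0 = b 0 := Function.update_of_ne (by omega) _ _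
  have key := fun o p (ho : o < 6) (hp : p ≤ (b 0).toNat) => pfData_update_sub b hb hi hk hc hci hck ho hp
  refine ⟨?_, ?_, ?_⟩
  · rw [coeffU_eq hci, coeffU_eq hck, coeffU_eq hc, h0i, h0k, ← sum_sub_distrib, mul_sum]
    exact sum_congr rfl fun p hp => key 4 p (by norm_num) (Nat.lt_succ_iff.1 (mem_range.1 hp))
  · rw [coeffW_eq hci, coeffW_eq hck, coeffW_eq hc, h0i, h0k, ← sum_sub_distrib, mul_sum]
    exact sum_congr rfl fun p hp => key 2 p (by norm_num) (Nat.lt_succ_iff.1 (mem_range.1 hp))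
  · rw [coeffV_eq hci, coeffV_eq hck, coeffV_eq hc, h0i, h0k, ← sum_sub_distrib, mul_sum]
    refine sum_congr rfl fun o ho => ?_
    rw [← sum_sub_distrib, mul_sum]
    refine sum_congr rfl fun p hp => ?_
    rw [← sub_mul, key o p (mem_range.1 ho) (Nat.lt_succ_iff.1 (mem_range.1 hp))]
    ring

/-! ### Partner independence of the conjecture's right-hand sides -/

/-- The ζ-free right-hand side `U(b)W(b+e_j) − U(b+e_j)W(b)` does not depend on the partner `j`. -/
theorem wedgeQ_partner_independent (b : ℕ → ℤ) (hb : InBox b) (hd : 0 ≤ dOf b) {i k : ℕ} (hi : i ∈ range 7)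
    (hk : k ∈ range 7) (hli : b (i + 1) ≤ b 0) (hlk : b (k + 1) ≤ b 0) :
    coeffU b * coeffW (Function.update b (i + 1) (b (i + 1) + 1)) -
        coeffU (Function.update b (i + 1) (b (i + 1) + 1)) * coeffW b =
      coeffU b * coeffW (Function.update b (k + 1) (b (k + 1) + 1)) -
        coeffU (Function.update b (k + 1) (b (k + 1) + 1)) * coeffW b := by
  obtain ⟨hU, hW, -⟩ := coeff_update_sub b hb hd hi hk hli hlk
  linear_combination coeffU b * hW - coeffW b * hU

/-- The right-hand side of the integral identity, `(W(b') − 2ζ(2)U(b'))·F̃₇(b) − (W(b) − 2ζ(2)U(b))·F̃₇(b')` with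
`b' = b + e_j`, does not depend on the partner `j` (coefficient linearity + Lemma 1 for `F̃₇`). -/
theorem wedgeI_partner_independent (b : ℕ → ℤ) (hb : InBox b) (hd : 0 ≤ dOf b) {i k : ℕ} (hi : i ∈ range 7)
    (hk : k ∈ range 7) (hall : ∀ l ∈ range 7, b (l + 1) ≤ b 0) :
    ((coeffW (Function.update b (i + 1) (b (i + 1) + 1)) : ℝ) -
          2 * zetaValue 2 * coeffU (Function.update b (i + 1) (b (i + 1) + 1))) * vwpDual 7 b -
        ((coeffW b : ℝ) - 2 * zetaValue 2 * coeffU b) * vwpDual 7 (Function.update b (i + 1) (b (i + 1) + 1)) =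
      ((coeffW (Function.update b (k + 1) (b (k + 1) + 1)) : ℝ) -
          2 * zetaValue 2 * coeffU (Function.update b (k + 1) (b (k + 1) + 1))) * vwpDual 7 b -
        ((coeffW b : ℝ) - 2 * zetaValue 2 * coeffU b) * vwpDual 7 (Function.update b (k + 1) (b (k + 1) + 1)) := by
  obtain ⟨hU, hW, -⟩ := coeff_update_sub b hb hd hi hk (hall i hi) (hall k hk)
  have hU' := congrArg (fun q : ℚ => (q : ℝ)) hU
  have hW' := congrArg (fun q : ℚ => (q : ℝ)) hW
  push_cast at hU' hW'
  have hF := vwpDual_seven_contiguity b hb.1 (fun l hl => ⟨(hb.2 l hl).1, hall l hl⟩)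
    (by unfold dOf at hd; linarith) hi hk
  push_cast at hF
  linear_combination vwpDual 7 b * hW' - 2 * zetaValue 2 * vwpDual 7 b * hU' -
    ((coeffW b : ℝ) - 2 * zetaValue 2 * coeffU b) * hF

/-! ### The conjecture implies the shape of Brown–Zudilin's decomposition (4), with explicit `P̂, P` -/

/-- Box and sum bound for the partner shift written with `j ∈ [1,7]`. -/
theorem region_update (b : ℕ → ℤ) (hreg : ∀ i ∈ Icc 1 7, 0 ≤ b i ∧ 2 * b i ≤ b 0 + 1) (hd : 0 ≤ dOf b)
    {j : ℕ} (hj : j ∈ Icc 1 7) (hpart : 2 * (b j + 1) ≤ b 0 + 1) :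
    InBox (Function.update b j (b j + 1)) ∧
      ∑ i ∈ range 7, Function.update b j (b j + 1) (i + 1) ≤ 3 * Function.update b j (b j + 1) 0 + 1 := by
  have hbox := inBox_of_region b hreg hj hpart
  obtain ⟨i, rfl⟩ : ∃ i, j = i + 1 := ⟨j - 1, by have := (mem_Icc.1 hj).1; omega⟩
  have hi : i ∈ range 7 := by have := (mem_Icc.1 hj).2; exact mem_range.2 (by omega)
  have hle : b (i + 1) ≤ b 0 := by have := (hreg (i + 1) hj).1; linarith
  exact box_update b hbox hd hi hle

/-- **The conjecture implies (4) with EXPLICIT `P̂, P`.**  Under `wedgeDictionary`, for `a` in its region: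
`I(a) = Q(a)·(2ζ(5) + 4ζ(3)ζ(2)) − 4·P̂·ζ(2) − 2·P` with `P̂ = ρ(U V′ − U′ V)`, `P = ρ(W′ V − W V′)`
(`′` = at `b + e_j`; substitute `vwp_decomposition` at `b` and `b + e_j` and the `Q`-identity). -/
theorem cellularIntegral_eq_of_wedgeDictionary (hW : wedgeDictionary) (a : Fin 8 → ℤ) {j : ℕ} (hj : j ∈ Icc 1 7)
    (hconv : Converges a) (hreg : ∀ i ∈ Icc 1 7, 0 ≤ bOfA a i ∧ 2 * bOfA a i ≤ bOfA a 0 + 1)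
    (hd : 0 ≤ dOf (bOfA a)) (hpart : 2 * (bOfA a j + 1) ≤ bOfA a 0 + 1) :
    cellularIntegral a =
      (QOf a : ℝ) * (2 * zetaValue 5 + 4 * zetaValue 3 * zetaValue 2) -
        4 * ((rhoOf a * (coeffU (bOfA a) * coeffV (Function.update (bOfA a) j (bOfA a j + 1)) -
              coeffU (Function.update (bOfA a) j (bOfA a j + 1)) * coeffV (bOfA a)) : ℚ) : ℝ) * zetaValue 2 -
        2 * ((rhoOf a * (coeffW (Function.update (bOfA a) j (bOfA a j + 1)) * coeffV (bOfA a) -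
              coeffW (bOfA a) * coeffV (Function.update (bOfA a) j (bOfA a j + 1))) : ℚ) : ℝ) := by
  obtain ⟨hQ, hI⟩ := hW a j hj hconv hreg hd hpart
  set b := bOfA a with hb
  set b' := Function.update b j (b j + 1) with hb'
  have hbox := inBox_of_region b hreg hj hpart
  obtain ⟨hbox', hsum'⟩ := region_update b hreg hd hj hpart
  have h1 := (vwp_decomposition b hbox (sum_le_of_dOf b hd)).2
  have h2 := (vwp_decomposition b' hbox' hsum').2
  have hQ' : ((QOf a : ℤ) : ℝ) = (rhoOf a : ℝ) * ((coeffU b : ℝ) * coeffW b' - coeffU b' * coeffW b) := by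
    have h := congrArg (fun q : ℚ => (q : ℝ)) hQ
    push_cast at h
    exact h
  rw [hI, h1, h2]
  push_cast
  rw [hQ']
  ring

/-- Hence, on its region, the conjecture implies the SHAPE of the cited named fact
`BrownZudilin2022.decomposition` ((4) with leading coefficient (17)):
`∃ P̂ P ∈ ℚ, I(a) = Q(a)(2ζ(5) + 4ζ(3)ζ(2)) − 4P̂ζ(2) − 2P`. -/
theorem decomposition_shape_of_wedgeDictionary (hW : wedgeDictionary) (a : Fin 8 → ℤ) {j : ℕ}
    (hj : j ∈ Icc 1 7) (hconv : Converges a)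
    (hreg : ∀ i ∈ Icc 1 7, 0 ≤ bOfA a i ∧ 2 * bOfA a i ≤ bOfA a 0 + 1)
    (hd : 0 ≤ dOf (bOfA a)) (hpart : 2 * (bOfA a j + 1) ≤ bOfA a 0 + 1) :
    ∃ Phat P : ℚ, cellularIntegral a =
      (QOf a : ℝ) * (2 * zetaValue 5 + 4 * zetaValue 3 * zetaValue 2) -
        4 * (Phat : ℝ) * zetaValue 2 - 2 * (P : ℝ) :=
  ⟨_, _, cellularIntegral_eq_of_wedgeDictionary hW a hj hconv hreg hd hpart⟩

end Summit.KontsevichZagierPeriods.Zeta5Search.WedgeDictionary
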